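import Summits.Ventures.CertifiedManyBodySolver.Rows.TorusCeilingSectors
import Summits.Ventures.CertifiedManyBodySolver.Rows.TorusCeilingCoordSpinSeam
import HarnessLib

/-!
# Spin-twisted torus ceiling V(c) — the sector rows as computed: `L × L` (every twist / seam table), CRT `3 × 5`, `3 × 4`

HONEST FRAMING: first certified bounds; not a superconductivity verdict; every number certified or
labelled float.
Specialisations of `homTorusSpinTwist_minEnergyOn_upDownSector_div_ge_of_window_certificate_avg` to the
carriers of the CAL ceiling page, in every sector `(N↑, N↓) = (a, b)` with the density rows at the mean
filling `(a + b)/(2V)`: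
* `coordSpinTwist_…_upDownSector_…`, `coordSpinSeam_…_upDownSector_…` — the `L × L` torus (`L ≥ 3`,
  window spreads `≤ M`, `M + 1 ≤ L`) with every `U(1)↑ × U(1)↓` twist resp. seam table, e.g. the row
  `3 × 3`, `(↑: P,P; ↓: A,A)`, `(N↑, N↓) = (4, 5)`;
* `crt35SpinTwist_…_upDownSector_…`, `crt35Seam_…_upDownSector_…` — the `3 × 5` torus `crtHom35`,
  e.g. the row `(P, A)`, `(N↑, N↓) = (8, 7)`;
* `crt34SpinTwist_…_upDownSector_…`, `crt34Seam_…_upDownSector_…` — the `3 × 4` torus `crtHom34`.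

The numerical rows are ED references (certified or labelled float), not part of this file.
[cite: Han2020Bootstrap, §3] [cite: ShastrySutherland1990] [cite: Gros1992] [cite: LiebPRL1989, proof of Theorem 1]
-/

noncomputable section

open Matrix Finset
open Literature.MathematicalPhysics.QuantumLattice
open Literature.MathematicalPhysics.QuantumFieldTheory hiding Site
open Literature.MathematicalPhysics.QuantumManyBody.StateRelaxation
open Literature.Probability.LatticeModels
open HubbardWave0
open scoped ComplexOrder ComplexConjugate

namespace Summit.Ventures.CertifiedManyBodySolver.Rows

/-! ### §4. The rows as computed: `L × L` (every twist / seam table) and the CRT rings `3 × 5`, `3 × 4` -/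

section CoordSectors

/-- **Spin-twisted `L × L` torus, every twist, every sector `(N↑, N↓)`.** As
`coordSpinTwist_minEnergyOn_div_ge_of_window_certificate` (`L ≥ 3`, spreads `≤ M`, `M + 1 ≤ L`), in the sector
`(N↑, N↓) = (a, b)`, density rows at the mean filling `(a + b)/(2L²)`.
[cite: ShastrySutherland1990] [cite: Han2020Bootstrap, §3] [cite: LiebPRL1989, proof of Theorem 1] -/
theorem coordSpinTwist_minEnergyOn_upDownSector_div_ge_of_window_certificate (L : ℕ) [NeZero L] (hL : 3 ≤ L)
    (t U : ℝ) (κt : Fin 2 → Fin 2 → Circle) {nu nd : ℕ} (hnu : nu ≤ Fintype.card (FermionTorus 2 L))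
    (hnd : nd ≤ Fintype.card (FermionTorus 2 L))
    {Λ Λ' : Finset (Site 2)} (hΛ : Λ ⊆ Λ') {M : ℕ} (hM : M + 1 ≤ L)
    (hspread : ∀ x ∈ Λ', ∀ y ∈ Λ', ∀ i, |x i - y i| ≤ (M : ℤ))
    (hclosed : ∀ x ∈ Λ, ∀ i : Fin 2, x + unitVec i ∈ Λ' ∧ x - unitVec i ∈ Λ')
    (h0 : thicken ({0} : Finset (Site 2)) 1 ⊆ Λ') (hz : (0 : Site 2) ∈ Λ')
    (μ : Fin 2 → ℝ) (ν : ℝ)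
    {m : Type*} [Fintype m] [DecidableEq m] {Λm : Matrix m m ℂ} (hΛm : Λm.PosSemidef)
    (O : m → FermionOp Λ')
    {κ : Type*} (s : Finset κ) (B : κ → FermionOp Λ)
    {ι : Type*} (tt : Finset ι) (v : ι → Site 2) (hsh : ∀ l, shiftSet (v l) Λ ⊆ Λ') (Y : ι → FermionOp Λ)
    {γ : Type*} (u : Finset γ) (b : γ → ℂ) (cw : γ → List (Orb (PolySite Λ') × Bool))
    (hcw : ∀ j ∈ u, ladderCharge (cw j) ≠ 0 ∨ ladderSpinCharge (cw j) ≠ 0)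
    {δ : Type*} (ah : Finset δ) (dc : δ → ℝ) (V : δ → FermionOp Λ')
    {κ'' : Type*} (w : Finset κ'') (a : κ'' → ℂ) (word : κ'' → List (Orb (PolySite Λ') × Bool)) {c : ℝ}
    (hcert : fermionEmbed (PolySite.incl h0) ((hubbardFermionInteraction 2 t U).meanEnergyObs 1) -
        (c : ℂ) • (1 : FermionOp Λ') -
        ∑ σ : Fin 2, ((μ σ : ℝ) : ℂ) • (nAt 0 hz σ - ((ν : ℝ) : ℂ) • (1 : FermionOp Λ')) =
      gramForm Λm O +
        (∑ k ∈ s, ((hubbardFermionInteraction 2 t U).localHamiltonian Λ' * fermionEmbed (PolySite.incl hΛ) (B k) -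
            fermionEmbed (PolySite.incl hΛ) (B k) * (hubbardFermionInteraction 2 t U).localHamiltonian Λ') +
          ∑ l ∈ tt, (fermionEmbed (PolySite.incl (hsh l)) (fermionEmbed (PolySite.shiftEmb (v l) Λ) (Y l)) -
            fermionEmbed (PolySite.incl hΛ) (Y l)) +
          ∑ j ∈ u, b j • ladderWord (cw j)) +
        (∑ m' ∈ ah, ((dc m' : ℝ) : ℂ) • ((V m')ᴴ - V m') + ∑ k ∈ w, a k • ladderWord (word k))) :
    c - ∑ k ∈ w, ‖a k‖ + (∑ σ : Fin 2, μ σ) * (((nu : ℝ) + nd) / 2 / (L : ℝ) ^ 2 - ν) ≤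
      (homHubbardSpinMag ((Int.castAddHom (ZMod L)).compLeft (Fin 2)) (fun _ => κt) t U).minEnergyOn
          (szSector (nu + nd) (((nu : ℝ) - nd) / 2)) / (L : ℝ) ^ 2 := by
  have hInj' : Set.InjOn ((Int.castAddHom (ZMod L)).compLeft (Fin 2)) ↑Λ' :=
    injOn_coordHom_of_spread hM hspread
  have hd : Function.Injective (signedHop ((Int.castAddHom (ZMod L)).compLeft (Fin 2))) :=
    injective_signedHop_coordHom hL
  exact homTorusSpinTwist_minEnergyOn_upDownSector_div_ge_of_window_certificate_avg _ t U κt hd hnu hnd hΛ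
    hclosed h0 hz hInj' μ ν hΛm O s B tt v hsh Y u b cw hcw ah dc V w a word hcert

/-- **Spin-twisted `L × L` torus in seam form, every seam table, every sector `(N↑, N↓)`** — the exact
diagonalisation convention (phase `η i σ` on the `i`-hops of species `σ` leaving `x_i = L − 1`), e.g. the
`3 × 3` row `(↑: P,P; ↓: A,A)`, `(N↑, N↓) = (4, 5)`.  Density rows at the mean filling `(a + b)/(2L²)`.
[cite: ShastrySutherland1990] [cite: Han2020Bootstrap, §3] [cite: Gros1992] [cite: LiebPRL1989, proof of Theorem 1] -/
theorem coordSpinSeam_minEnergyOn_upDownSector_div_ge_of_window_certificate (L : ℕ) [NeZero L] (hL : 3 ≤ L)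
    (t U : ℝ) (η : Fin 2 → Fin 2 → Circle) {nu nd : ℕ} (hnu : nu ≤ Fintype.card (FermionTorus 2 L))
    (hnd : nd ≤ Fintype.card (FermionTorus 2 L))
    {Λ Λ' : Finset (Site 2)} (hΛ : Λ ⊆ Λ') {M : ℕ} (hM : M + 1 ≤ L)
    (hspread : ∀ x ∈ Λ', ∀ y ∈ Λ', ∀ i, |x i - y i| ≤ (M : ℤ))
    (hclosed : ∀ x ∈ Λ, ∀ i : Fin 2, x + unitVec i ∈ Λ' ∧ x - unitVec i ∈ Λ')
    (h0 : thicken ({0} : Finset (Site 2)) 1 ⊆ Λ') (hz : (0 : Site 2) ∈ Λ')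
    (μ : Fin 2 → ℝ) (ν : ℝ)
    {m : Type*} [Fintype m] [DecidableEq m] {Λm : Matrix m m ℂ} (hΛm : Λm.PosSemidef)
    (O : m → FermionOp Λ')
    {κ : Type*} (s : Finset κ) (B : κ → FermionOp Λ)
    {ι : Type*} (tt : Finset ι) (v : ι → Site 2) (hsh : ∀ l, shiftSet (v l) Λ ⊆ Λ') (Y : ι → FermionOp Λ)
    {γ : Type*} (u : Finset γ) (b : γ → ℂ) (cw : γ → List (Orb (PolySite Λ') × Bool))
    (hcw : ∀ j ∈ u, ladderCharge (cw j) ≠ 0 ∨ ladderSpinCharge (cw j) ≠ 0)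
    {δ : Type*} (ah : Finset δ) (dc : δ → ℝ) (V : δ → FermionOp Λ')
    {κ'' : Type*} (w : Finset κ'') (a : κ'' → ℂ) (word : κ'' → List (Orb (PolySite Λ') × Bool)) {c : ℝ}
    (hcert : fermionEmbed (PolySite.incl h0) ((hubbardFermionInteraction 2 t U).meanEnergyObs 1) -
        (c : ℂ) • (1 : FermionOp Λ') -
        ∑ σ : Fin 2, ((μ σ : ℝ) : ℂ) • (nAt 0 hz σ - ((ν : ℝ) : ℂ) • (1 : FermionOp Λ')) =
      gramForm Λm O +
        (∑ k ∈ s, ((hubbardFermionInteraction 2 t U).localHamiltonian Λ' * fermionEmbed (PolySite.incl hΛ) (B k) -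
            fermionEmbed (PolySite.incl hΛ) (B k) * (hubbardFermionInteraction 2 t U).localHamiltonian Λ') +
          ∑ l ∈ tt, (fermionEmbed (PolySite.incl (hsh l)) (fermionEmbed (PolySite.shiftEmb (v l) Λ) (Y l)) -
            fermionEmbed (PolySite.incl hΛ) (Y l)) +
          ∑ j ∈ u, b j • ladderWord (cw j)) +
        (∑ m' ∈ ah, ((dc m' : ℝ) : ℂ) • ((V m')ᴴ - V m') + ∑ k ∈ w, a k • ladderWord (word k))) :
    c - ∑ k ∈ w, ‖a k‖ + (∑ σ : Fin 2, μ σ) * (((nu : ℝ) + nd) / 2 / (L : ℝ) ^ 2 - ν) ≤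
      (homHubbardSpinMag ((Int.castAddHom (ZMod L)).compLeft (Fin 2))
          (fun x i σ => if (x i).val = L - 1 then η i σ else 1) t U).minEnergyOn
          (szSector (nu + nd) (((nu : ℝ) - nd) / 2)) / (L : ℝ) ^ 2 := by
  obtain ⟨κt, -, h⟩ := minEnergyOn_homHubbardSpinMag_coordSeam (N := L) η t U (nu + nd) (((nu : ℝ) - nd) / 2)
  rw [h]
  exact coordSpinTwist_minEnergyOn_upDownSector_div_ge_of_window_certificate L hL t U κt hnu hnd hΛ hM hspread
    hclosed h0 hz μ ν hΛm O s B tt v hsh Y u b cw hcw ah dc V w a word hcert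

end CoordSectors

section CRTSectors

/-- **Spin-twisted `3 × 5` torus (`crtHom35`), every `U(1)↑ × U(1)↓` twist, every sector `(N↑, N↓)`** (spreads of
`Λ'` at most `2` resp. `4`; `a, b ≤ 15`), density rows at the mean filling `(a + b)/30`.
[cite: ShastrySutherland1990] [cite: Han2020Bootstrap, §3] [cite: LiebPRL1989, proof of Theorem 1] -/
theorem crt35SpinTwist_minEnergyOn_upDownSector_div_ge_of_window_certificate (t U : ℝ) (κt : Fin 2 → Fin 2 → Circle)
    {nu nd : ℕ} (hnu : nu ≤ Fintype.card (FermionTorus 1 15)) (hnd : nd ≤ Fintype.card (FermionTorus 1 15))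
    {Λ Λ' : Finset (Site 2)} (hΛ : Λ ⊆ Λ')
    (hspread : ∀ x ∈ Λ', ∀ y ∈ Λ', |x 0 - y 0| ≤ (2 : ℤ) ∧ |x 1 - y 1| ≤ (4 : ℤ))
    (hclosed : ∀ x ∈ Λ, ∀ i : Fin 2, x + unitVec i ∈ Λ' ∧ x - unitVec i ∈ Λ')
    (h0 : thicken ({0} : Finset (Site 2)) 1 ⊆ Λ') (hz : (0 : Site 2) ∈ Λ')
    (μ : Fin 2 → ℝ) (ν : ℝ)
    {m : Type*} [Fintype m] [DecidableEq m] {Λm : Matrix m m ℂ} (hΛm : Λm.PosSemidef)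
    (O : m → FermionOp Λ')
    {κ : Type*} (s : Finset κ) (B : κ → FermionOp Λ)
    {ι : Type*} (tt : Finset ι) (v : ι → Site 2) (hsh : ∀ l, shiftSet (v l) Λ ⊆ Λ') (Y : ι → FermionOp Λ)
    {γ : Type*} (u : Finset γ) (b : γ → ℂ) (cw : γ → List (Orb (PolySite Λ') × Bool))
    (hcw : ∀ j ∈ u, ladderCharge (cw j) ≠ 0 ∨ ladderSpinCharge (cw j) ≠ 0)
    {δ : Type*} (ah : Finset δ) (dc : δ → ℝ) (V : δ → FermionOp Λ')
    {κ'' : Type*} (w : Finset κ'') (a : κ'' → ℂ) (word : κ'' → List (Orb (PolySite Λ') × Bool)) {c : ℝ}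
    (hcert : fermionEmbed (PolySite.incl h0) ((hubbardFermionInteraction 2 t U).meanEnergyObs 1) -
        (c : ℂ) • (1 : FermionOp Λ') -
        ∑ σ : Fin 2, ((μ σ : ℝ) : ℂ) • (nAt 0 hz σ - ((ν : ℝ) : ℂ) • (1 : FermionOp Λ')) =
      gramForm Λm O +
        (∑ k ∈ s, ((hubbardFermionInteraction 2 t U).localHamiltonian Λ' * fermionEmbed (PolySite.incl hΛ) (B k) -
            fermionEmbed (PolySite.incl hΛ) (B k) * (hubbardFermionInteraction 2 t U).localHamiltonian Λ') +
          ∑ l ∈ tt, (fermionEmbed (PolySite.incl (hsh l)) (fermionEmbed (PolySite.shiftEmb (v l) Λ) (Y l)) -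
            fermionEmbed (PolySite.incl hΛ) (Y l)) +
          ∑ j ∈ u, b j • ladderWord (cw j)) +
        (∑ m' ∈ ah, ((dc m' : ℝ) : ℂ) • ((V m')ᴴ - V m') + ∑ k ∈ w, a k • ladderWord (word k))) :
    c - ∑ k ∈ w, ‖a k‖ + (∑ σ : Fin 2, μ σ) * (((nu : ℝ) + nd) / 2 / 15 - ν) ≤
      (homHubbardSpinMag crtHom35 (fun _ => κt) t U).minEnergyOn (szSector (nu + nd) (((nu : ℝ) - nd) / 2)) / 15 := by
  have hInj' : Set.InjOn crtHom35 ↑Λ' :=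
    injOn_ringHom_two_of_spread 15 ![10, 6] (M₀ := 2) (M₁ := 4)
      (fun a' b' h₁ h₂ h₃ h₄ h₅ => by
        simp only [Matrix.cons_val_zero, Matrix.cons_val_one] at h₅
        omega) hspread
  have hd : Function.Injective (signedHop crtHom35) := injective_signedHop_ringHom 15 ![10, 6] (by decide)
  have h := homTorusSpinTwist_minEnergyOn_upDownSector_div_ge_of_window_certificate_avg crtHom35 t U κt hd hnu hnd hΛ
    hclosed h0 hz hInj' μ ν hΛm O s B tt v hsh Y u b cw hcw ah dc V w a word hcert
  simp only [Nat.cast_ofNat, pow_one] at h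
  exact h

/-- **One-seam twisted `3 × 5` torus (`crtHom35`, spin-blind seam phases `η ∈ U(1)²`), every sector
`(N↑, N↓)`** — e.g. the row `3 × 5`, `(P, A)`, `(N↑, N↓) = (8, 7)`; density rows at the mean filling.
[cite: Han2020Bootstrap, §3] [cite: Gros1992] [cite: LiebPRL1989, proof of Theorem 1] -/
theorem crt35Seam_minEnergyOn_upDownSector_div_ge_of_window_certificate (t U : ℝ) (η : Fin 2 → Circle)
    {nu nd : ℕ} (hnu : nu ≤ Fintype.card (FermionTorus 1 15)) (hnd : nd ≤ Fintype.card (FermionTorus 1 15))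
    {Λ Λ' : Finset (Site 2)} (hΛ : Λ ⊆ Λ')
    (hspread : ∀ x ∈ Λ', ∀ y ∈ Λ', |x 0 - y 0| ≤ (2 : ℤ) ∧ |x 1 - y 1| ≤ (4 : ℤ))
    (hclosed : ∀ x ∈ Λ, ∀ i : Fin 2, x + unitVec i ∈ Λ' ∧ x - unitVec i ∈ Λ')
    (h0 : thicken ({0} : Finset (Site 2)) 1 ⊆ Λ') (hz : (0 : Site 2) ∈ Λ')
    (μ : Fin 2 → ℝ) (ν : ℝ)
    {m : Type*} [Fintype m] [DecidableEq m] {Λm : Matrix m m ℂ} (hΛm : Λm.PosSemidef)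
    (O : m → FermionOp Λ')
    {κ : Type*} (s : Finset κ) (B : κ → FermionOp Λ)
    {ι : Type*} (tt : Finset ι) (v : ι → Site 2) (hsh : ∀ l, shiftSet (v l) Λ ⊆ Λ') (Y : ι → FermionOp Λ)
    {γ : Type*} (u : Finset γ) (b : γ → ℂ) (cw : γ → List (Orb (PolySite Λ') × Bool))
    (hcw : ∀ j ∈ u, ladderCharge (cw j) ≠ 0 ∨ ladderSpinCharge (cw j) ≠ 0)
    {δ : Type*} (ah : Finset δ) (dc : δ → ℝ) (V : δ → FermionOp Λ')
    {κ'' : Type*} (w : Finset κ'') (a : κ'' → ℂ) (word : κ'' → List (Orb (PolySite Λ') × Bool)) {c : ℝ}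
    (hcert : fermionEmbed (PolySite.incl h0) ((hubbardFermionInteraction 2 t U).meanEnergyObs 1) -
        (c : ℂ) • (1 : FermionOp Λ') -
        ∑ σ : Fin 2, ((μ σ : ℝ) : ℂ) • (nAt 0 hz σ - ((ν : ℝ) : ℂ) • (1 : FermionOp Λ')) =
      gramForm Λm O +
        (∑ k ∈ s, ((hubbardFermionInteraction 2 t U).localHamiltonian Λ' * fermionEmbed (PolySite.incl hΛ) (B k) -
            fermionEmbed (PolySite.incl hΛ) (B k) * (hubbardFermionInteraction 2 t U).localHamiltonian Λ') +
          ∑ l ∈ tt, (fermionEmbed (PolySite.incl (hsh l)) (fermionEmbed (PolySite.shiftEmb (v l) Λ) (Y l)) -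
            fermionEmbed (PolySite.incl hΛ) (Y l)) +
          ∑ j ∈ u, b j • ladderWord (cw j)) +
        (∑ m' ∈ ah, ((dc m' : ℝ) : ℂ) • ((V m')ᴴ - V m') + ∑ k ∈ w, a k • ladderWord (word k))) :
    c - ∑ k ∈ w, ‖a k‖ + (∑ σ : Fin 2, μ σ) * (((nu : ℝ) + nd) / 2 / 15 - ν) ≤
      (homHubbardMag crtHom35 (crtSeam 15 3 5 η) t U).minEnergyOn (szSector (nu + nd) (((nu : ℝ) - nd) / 2)) / 15 := by
  obtain ⟨κ', -, -, h⟩ := minEnergyOn_homHubbardMag_crtSeam35 η t U (nu + nd) (((nu : ℝ) - nd) / 2)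
  rw [h, ← homHubbardSpinMag_const_spinBlind]
  exact crt35SpinTwist_minEnergyOn_upDownSector_div_ge_of_window_certificate t U (fun i _ => κ' i) hnu hnd hΛ hspread
    hclosed h0 hz μ ν hΛm O s B tt v hsh Y u b cw hcw ah dc V w a word hcert

/-- **Spin-twisted `3 × 4` torus (`crtHom34`), every `U(1)↑ × U(1)↓` twist, every sector `(N↑, N↓)`** (spreads
`≤ 2`, `≤ 3`; `a, b ≤ 12`), density rows at the mean filling `(a + b)/24`.
[cite: ShastrySutherland1990] [cite: Han2020Bootstrap, §3] [cite: LiebPRL1989, proof of Theorem 1] -/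
theorem crt34SpinTwist_minEnergyOn_upDownSector_div_ge_of_window_certificate (t U : ℝ) (κt : Fin 2 → Fin 2 → Circle)
    {nu nd : ℕ} (hnu : nu ≤ Fintype.card (FermionTorus 1 12)) (hnd : nd ≤ Fintype.card (FermionTorus 1 12))
    {Λ Λ' : Finset (Site 2)} (hΛ : Λ ⊆ Λ')
    (hspread : ∀ x ∈ Λ', ∀ y ∈ Λ', |x 0 - y 0| ≤ (2 : ℤ) ∧ |x 1 - y 1| ≤ (3 : ℤ))
    (hclosed : ∀ x ∈ Λ, ∀ i : Fin 2, x + unitVec i ∈ Λ' ∧ x - unitVec i ∈ Λ')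
    (h0 : thicken ({0} : Finset (Site 2)) 1 ⊆ Λ') (hz : (0 : Site 2) ∈ Λ')
    (μ : Fin 2 → ℝ) (ν : ℝ)
    {m : Type*} [Fintype m] [DecidableEq m] {Λm : Matrix m m ℂ} (hΛm : Λm.PosSemidef)
    (O : m → FermionOp Λ')
    {κ : Type*} (s : Finset κ) (B : κ → FermionOp Λ)
    {ι : Type*} (tt : Finset ι) (v : ι → Site 2) (hsh : ∀ l, shiftSet (v l) Λ ⊆ Λ') (Y : ι → FermionOp Λ)
    {γ : Type*} (u : Finset γ) (b : γ → ℂ) (cw : γ → List (Orb (PolySite Λ') × Bool))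
    (hcw : ∀ j ∈ u, ladderCharge (cw j) ≠ 0 ∨ ladderSpinCharge (cw j) ≠ 0)
    {δ : Type*} (ah : Finset δ) (dc : δ → ℝ) (V : δ → FermionOp Λ')
    {κ'' : Type*} (w : Finset κ'') (a : κ'' → ℂ) (word : κ'' → List (Orb (PolySite Λ') × Bool)) {c : ℝ}
    (hcert : fermionEmbed (PolySite.incl h0) ((hubbardFermionInteraction 2 t U).meanEnergyObs 1) -
        (c : ℂ) • (1 : FermionOp Λ') -
        ∑ σ : Fin 2, ((μ σ : ℝ) : ℂ) • (nAt 0 hz σ - ((ν : ℝ) : ℂ) • (1 : FermionOp Λ')) =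
      gramForm Λm O +
        (∑ k ∈ s, ((hubbardFermionInteraction 2 t U).localHamiltonian Λ' * fermionEmbed (PolySite.incl hΛ) (B k) -
            fermionEmbed (PolySite.incl hΛ) (B k) * (hubbardFermionInteraction 2 t U).localHamiltonian Λ') +
          ∑ l ∈ tt, (fermionEmbed (PolySite.incl (hsh l)) (fermionEmbed (PolySite.shiftEmb (v l) Λ) (Y l)) -
            fermionEmbed (PolySite.incl hΛ) (Y l)) +
          ∑ j ∈ u, b j • ladderWord (cw j)) +
        (∑ m' ∈ ah, ((dc m' : ℝ) : ℂ) • ((V m')ᴴ - V m') + ∑ k ∈ w, a k • ladderWord (word k))) :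
    c - ∑ k ∈ w, ‖a k‖ + (∑ σ : Fin 2, μ σ) * (((nu : ℝ) + nd) / 2 / 12 - ν) ≤
      (homHubbardSpinMag crtHom34 (fun _ => κt) t U).minEnergyOn (szSector (nu + nd) (((nu : ℝ) - nd) / 2)) / 12 := by
  have hInj' : Set.InjOn crtHom34 ↑Λ' :=
    injOn_ringHom_two_of_spread 12 ![4, 9] (M₀ := 2) (M₁ := 3)
      (fun a' b' h₁ h₂ h₃ h₄ h₅ => by
        simp only [Matrix.cons_val_zero, Matrix.cons_val_one] at h₅
        omega) hspread
  have hd : Function.Injective (signedHop crtHom34) := injective_signedHop_ringHom 12 ![4, 9] (by decide)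
  have h := homTorusSpinTwist_minEnergyOn_upDownSector_div_ge_of_window_certificate_avg crtHom34 t U κt hd hnu hnd hΛ
    hclosed h0 hz hInj' μ ν hΛm O s B tt v hsh Y u b cw hcw ah dc V w a word hcert
  simp only [Nat.cast_ofNat, pow_one] at h
  exact h

/-- **One-seam twisted `3 × 4` torus (`crtHom34`, spin-blind seam phases), every sector `(N↑, N↓)`.**
[cite: Han2020Bootstrap, §3] [cite: Gros1992] [cite: LiebPRL1989, proof of Theorem 1] -/
theorem crt34Seam_minEnergyOn_upDownSector_div_ge_of_window_certificate (t U : ℝ) (η : Fin 2 → Circle)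
    {nu nd : ℕ} (hnu : nu ≤ Fintype.card (FermionTorus 1 12)) (hnd : nd ≤ Fintype.card (FermionTorus 1 12))
    {Λ Λ' : Finset (Site 2)} (hΛ : Λ ⊆ Λ')
    (hspread : ∀ x ∈ Λ', ∀ y ∈ Λ', |x 0 - y 0| ≤ (2 : ℤ) ∧ |x 1 - y 1| ≤ (3 : ℤ))
    (hclosed : ∀ x ∈ Λ, ∀ i : Fin 2, x + unitVec i ∈ Λ' ∧ x - unitVec i ∈ Λ')
    (h0 : thicken ({0} : Finset (Site 2)) 1 ⊆ Λ') (hz : (0 : Site 2) ∈ Λ')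
    (μ : Fin 2 → ℝ) (ν : ℝ)
    {m : Type*} [Fintype m] [DecidableEq m] {Λm : Matrix m m ℂ} (hΛm : Λm.PosSemidef)
    (O : m → FermionOp Λ')
    {κ : Type*} (s : Finset κ) (B : κ → FermionOp Λ)
    {ι : Type*} (tt : Finset ι) (v : ι → Site 2) (hsh : ∀ l, shiftSet (v l) Λ ⊆ Λ') (Y : ι → FermionOp Λ)
    {γ : Type*} (u : Finset γ) (b : γ → ℂ) (cw : γ → List (Orb (PolySite Λ') × Bool))
    (hcw : ∀ j ∈ u, ladderCharge (cw j) ≠ 0 ∨ ladderSpinCharge (cw j) ≠ 0)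
    {δ : Type*} (ah : Finset δ) (dc : δ → ℝ) (V : δ → FermionOp Λ')
    {κ'' : Type*} (w : Finset κ'') (a : κ'' → ℂ) (word : κ'' → List (Orb (PolySite Λ') × Bool)) {c : ℝ}
    (hcert : fermionEmbed (PolySite.incl h0) ((hubbardFermionInteraction 2 t U).meanEnergyObs 1) -
        (c : ℂ) • (1 : FermionOp Λ') -
        ∑ σ : Fin 2, ((μ σ : ℝ) : ℂ) • (nAt 0 hz σ - ((ν : ℝ) : ℂ) • (1 : FermionOp Λ')) =
      gramForm Λm O +
        (∑ k ∈ s, ((hubbardFermionInteraction 2 t U).localHamiltonian Λ' * fermionEmbed (PolySite.incl hΛ) (B k) -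
            fermionEmbed (PolySite.incl hΛ) (B k) * (hubbardFermionInteraction 2 t U).localHamiltonian Λ') +
          ∑ l ∈ tt, (fermionEmbed (PolySite.incl (hsh l)) (fermionEmbed (PolySite.shiftEmb (v l) Λ) (Y l)) -
            fermionEmbed (PolySite.incl hΛ) (Y l)) +
          ∑ j ∈ u, b j • ladderWord (cw j)) +
        (∑ m' ∈ ah, ((dc m' : ℝ) : ℂ) • ((V m')ᴴ - V m') + ∑ k ∈ w, a k • ladderWord (word k))) :
    c - ∑ k ∈ w, ‖a k‖ + (∑ σ : Fin 2, μ σ) * (((nu : ℝ) + nd) / 2 / 12 - ν) ≤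
      (homHubbardMag crtHom34 (crtSeam 12 3 4 η) t U).minEnergyOn (szSector (nu + nd) (((nu : ℝ) - nd) / 2)) / 12 := by
  obtain ⟨κ', -, -, h⟩ := minEnergyOn_homHubbardMag_crtSeam34 η t U (nu + nd) (((nu : ℝ) - nd) / 2)
  rw [h, ← homHubbardSpinMag_const_spinBlind]
  exact crt34SpinTwist_minEnergyOn_upDownSector_div_ge_of_window_certificate t U (fun i _ => κ' i) hnu hnd hΛ hspread
    hclosed h0 hz μ ν hΛm O s B tt v hsh Y u b cw hcw ah dc V w a word hcert

end CRTSectors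

end Summit.Ventures.CertifiedManyBodySolver.Rows

end
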